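import Literature.Analysis.FluidPDE.MildL3SmoothHolds
import Literature.Analysis.FluidPDE.MildL3SmoothOfKNSS
import Literature.Analysis.FluidPDE.KatoLocalBoundedProofs
import Literature.Analysis.FluidPDE.KatoLocalLerayPressureProofs
import Literature.Analysis.FluidPDE.NSBoundedMildSmoothing
import Literature.Analysis.FluidPDE.LocalLerayWeakStrongProofs
import Literature.Analysis.FluidPDE.SuitableWeakCongr
import HarnessLib

/-!
# Jia–Šverák 2014, proof of Thm. 3.1: the regular (mild) flow from the localised datum

Analysis/FluidPDE proofs file (theorems only, no new definitions, no new named facts), part of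
the proof of the named fact `Literature.Analysis.FluidPDE.jia_sverak_2014_theorem_3_2`
(`JiaSverak2014LocalRegularity.lean`; H. Jia, V. Šverák, Invent. Math. 196 (2014) =
arXiv:1204.0529, §3 Thm. 3.2). Thm. 3.1 (arXiv p. 7) compares the Leray solution `u` with "the
locally in time defined mild solution to NSE with initial data `u₀¹`" (the bounded, compactly
supported, divergence-free localisation of the datum, footnote 1), and its proof (p. 8) uses
that "by property of mild solutions, `‖a‖_{L⁵_tL⁵_x(ℝ³×[0,T(α,m,M)])} ≤ C(m,M)` […] and `a` is
regular in `ℝ³ × (0, T₁)` and `lim_{t→0+} ‖a(·,t) - u₀‖_{L²_loc(ℝ³)} = 0`".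

This file packages the regular flow from the tree's mild-solution theory: for bounded
divergence-free `a₀ ∈ L³ ∩ L^∞(ℝ³)` with `‖a₀‖_∞ ≤ A` there are absolute `c₁ > 0`, `C₁` and

* a Kato solution `w` on `[0, c₀/A²)` bounded by `2A` (`kato_local_bounded_holds`,
  Lemarié-Rieusset 2016, Thm. 5.1 / §9.9);
* a pressure `p_K` making `(w, p_K)` — hence its smooth representative `(a, p_K)` — a local
  Leray solution on the slab `(0, c₁/A²) × ℝ³` with datum `a₀` (`kato_isLocalLeraySolutionOn_holds`,
  Lemarié-Rieusset 2016, Thm. 15.1 (A));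
* a classical smooth representative `(a, π)` on `(0, 4c₁/A²)` (`mild_L3_smooth_holds`,
  Lemarié-Rieusset 2016, Thm. 9.12 / KNSS 2009, Prop. 4.1), bounded by `2A` everywhere;
* the parabolic gradient bound `√t ‖∇a(t,x)‖ ≤ C₁ A` on `(0, c₁/A²)` (KNSS 2009, Prop. 4.1,
  (4.5) with `k = 1`: `knss2009_local_smoothing_holds`, identified with `a` through the Oseen
  integral equation `ae_eq_heatExtension_sub_oseenDuhamel_of_memLp_three` and uniqueness of
  bounded solutions `exists_local_smooth_representative`).

Main result: `JiaSverak2014.exists_regular_flow`.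

## Mathlib / tree search

Tree: `kato_local_bounded_holds`, `kato_isLocalLeraySolutionOn_holds`, `mild_L3_smooth_holds`,
`knss2009_local_smoothing_holds`, `exists_local_smooth_representative`,
`ae_eq_heatExtension_sub_oseenDuhamel_of_memLp_three`, `exists_retract_representative`,
`oseenDuhamel_congr_ae_slice`, `ContinuousInLpOn.exists_forall_eLpNorm_le`,
`IsMildNSSolutionOn.isMildNSSolutionBetween_of_continuousInLpOn`, `norm_le_of_continuous_of_ae_eq`,
`ae_eq_strip_of_ae_slice`, `IsSuitableWeakSolutionOn.congr_ae`, `HasWeakSpatialGradientOn.congr_ae`,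
`IsClassicalNSSolutionOn.mono` (`lean search 'regular_flow|JiaSverak2014.*mild'`: nothing).
Mathlib: `Continuous.ae_eq_iff_eq`, `norm_iteratedFDeriv_fderiv`, `norm_iteratedFDeriv_zero`.

## References

* H. Jia, V. Šverák, Invent. Math. 196 (2014) = arXiv:1204.0529, §3 Thm. 3.1 (footnote 1) and
  its proof, pp. 7–8. Bib key `JiaSverak2014`.
* P. G. Lemarié-Rieusset, *The Navier–Stokes Problem in the 21st Century* (2016), Thm. 5.1,
  §9.9 / Thm. 9.12, Thm. 15.1 (A). Bib key `LemarieRieusset2016`.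
* G. Koch, N. Nadirashvili, G. Seregin, V. Šverák, Acta Math. 203 (2009) = arXiv:0709.3599, §4
  Prop. 4.1, (4.5). Bib key `KochNadirashviliSereginSverak2009`.
-/

noncomputable section

open MeasureTheory TopologicalSpace Set Function Filter Metric
open _root_.Topology
open scoped ENNReal NNReal RealInnerProductSpace

namespace Literature.Analysis.FluidPDE

namespace JiaSverak2014

/-- **Transfer of the slab local Leray structure to the smooth representative.** If `(w, p)` is
a local Leray solution on `(0,S) × ℝ³`, `S > 0`, and `a` is measurable on the strip with `a(t) = w(t)` a.e.
for every `t ∈ (0,S)`, then `(a, p)` is a local Leray solution on `(0,S) × ℝ³` with the same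
datum (all clauses see the velocity through integrals over subsets of the strip, on which
`a = w` a.e. by Fubini; `IsSuitableWeakSolutionOn.congr_ae`, `HasWeakSpatialGradientOn.congr_ae`).
[folklore] -/
theorem isLocalLeraySolutionOn_congr_slices {S ν : ℝ}
    {a₀ : (EuclideanSpace ℝ (Fin 3)) → (EuclideanSpace ℝ (Fin 3))}
    {w a : ℝ → (EuclideanSpace ℝ (Fin 3)) → (EuclideanSpace ℝ (Fin 3))} {p : ℝ → (EuclideanSpace ℝ (Fin 3)) → ℝ}
    (hS : 0 < S) (hw : IsLocalLeraySolutionOn S ν a₀ w p)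
    (ham : AEStronglyMeasurable (uncurry a) (volume.restrict (Ioo 0 S ×ˢ (univ : Set (EuclideanSpace ℝ (Fin 3))))))
    (hae : ∀ t ∈ Ioo 0 S, a t =ᵐ[volume] w t) :
    IsLocalLeraySolutionOn S ν a₀ a p := by
  -- `w = a` a.e. on the strip
  have hstrip : uncurry w =ᵐ[volume.restrict (Ioo 0 S ×ˢ (univ : Set (EuclideanSpace ℝ (Fin 3))))] uncurry a := by
    refine ae_eq_strip_of_ae_slice hw.aestronglyMeasurable ham ?_
    have hmem : ∀ᵐ t ∂(volume.restrict (Ioo (0 : ℝ) S)), t ∈ Ioo (0 : ℝ) S := ae_restrict_mem measurableSet_Ioo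
    filter_upwards [hmem] with t ht
    exact (hae t ht).symm
  have hstrip' : ∀ᵐ z ∂(volume.restrict (Ioo 0 S ×ˢ (univ : Set (EuclideanSpace ℝ (Fin 3))))), uncurry w z = uncurry a z := hstrip
  -- integrals of `|a|²` over sub-boxes agree with those of `|w|²`
  have hbox : ∀ (I : Set ℝ) (B : Set (EuclideanSpace ℝ (Fin 3))), I ⊆ Ioo 0 S →
      ∫⁻ z in I ×ˢ B, ‖a z.1 z.2‖ₑ ^ 2 = ∫⁻ z in I ×ˢ B, ‖w z.1 z.2‖ₑ ^ 2 := by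
    intro I B hI
    refine lintegral_congr_ae ?_
    have h := ae_restrict_of_ae_restrict_of_subset (prod_mono hI (subset_univ B)) hstrip'
    filter_upwards [h] with z hz
    have hz' : w z.1 z.2 = a z.1 z.2 := hz
    rw [hz']
  obtain ⟨G, hG, hGb⟩ := hw.uniformLocalGradient
  refine
    { suitable := hw.suitable.congr_ae hstrip' (Eventually.of_forall fun _ => rfl)
      sqIntegrable := fun K hK => by rw [hbox _ _ Subset.rfl]; exact hw.sqIntegrable K hK
      pressure := hw.pressure
      uniformLocalEnergy := fun R hR => ?_
      uniformLocalGradient := ⟨G, hG.congr_ae hstrip', hGb⟩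
      initial := fun K hK => ?_
      decay := fun R hR => ?_ }
  · obtain ⟨C, hC⟩ := hw.uniformLocalEnergy R hR
    refine ⟨C, ?_⟩
    have hmem : ∀ᵐ t ∂(volume.restrict (Ioo (0 : ℝ) S)), t ∈ Ioo (0 : ℝ) S := ae_restrict_mem measurableSet_Ioo
    filter_upwards [hC, hmem] with t ht htm x₀
    calc ∫⁻ x in ball x₀ R, ‖a t x‖ₑ ^ 2 = ∫⁻ x in ball x₀ R, ‖w t x‖ₑ ^ 2 := by
          refine lintegral_congr_ae ((ae_restrict_of_ae (hae t htm)).mono fun x hx => ?_)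
          show ‖a t x‖ₑ ^ 2 = ‖w t x‖ₑ ^ 2
          rw [hx]
      _ ≤ C := ht x₀
  · -- the datum: `∫_K |a t - a₀|² = ∫_K |w t - a₀|²` for `0 < t < S`
    have hev : ∀ᶠ t in 𝓝[>] (0 : ℝ), t ∈ Ioo (0 : ℝ) S := Ioo_mem_nhdsGT hS
    refine (hw.initial K hK).congr' (hev.mono fun t ht => ?_)
    refine lintegral_congr_ae ((ae_restrict_of_ae (hae t ht)).mono fun x hx => ?_)
    show ‖w t x - a₀ x‖ₑ ^ 2 = ‖a t x - a₀ x‖ₑ ^ 2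
    rw [hx]
  · have e : ∀ x₀ : EuclideanSpace ℝ (Fin 3), ∫⁻ z in Ioo 0 S ×ˢ ball x₀ R, ‖a z.1 z.2‖ₑ ^ 2 =
        ∫⁻ z in Ioo 0 S ×ˢ ball x₀ R, ‖w z.1 z.2‖ₑ ^ 2 := fun x₀ => hbox _ _ Subset.rfl
    simp only [e]
    exact hw.decay R hR

/-- **The regular flow from a bounded divergence-free datum** (Jia–Šverák 2014, Thm. 3.1 with
footnote 1 and proof, arXiv pp. 7–8: "let `a` be the locally in time defined mild solution to
NSE with initial data `u₀¹`", "`a` is regular in `ℝ³ × (0,T₁)` and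
`lim_{t→0+} ‖a(·,t) - u₀‖_{L²_loc(ℝ³)} = 0`"; the lifespan and bounds by Lemarié-Rieusset 2016,
Thm. 5.1 / §9.9 and KNSS 2009, Prop. 4.1). There are absolute constants `c₁ > 0` and `C₁ ≥ 0`
such that for every `A > 0` and every measurable, weakly divergence-free `a₀ ∈ L³(ℝ³)` with
`‖a₀‖_{L^∞} ≤ A` there are a velocity `a` and pressures `π`, `p_K` with:
`(a, p_K)` a local Leray solution on the slab `(0, c₁/A²) × ℝ³` with datum `a₀`
(`IsLocalLeraySolutionOn`); `(a, π)` a classical (jointly smooth) solution of the unit-viscosity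
unforced Navier–Stokes equations on `(0, 4c₁/A²)`; `|a(t,x)| ≤ 2A` there; and
`√t |∇a(t,x)| ≤ C₁ A` on `(0, c₁/A²)`. (The two pressures differ by a function of time; this
file does not record that.) [cite: JiaSverak2014, §3 Thm. 3.1 (footnote 1) and its proof (arXiv pp. 7–8)] [cite: LemarieRieusset2016, Thm. 5.1, §9.9, Thm. 15.1 (A)] [cite: KochNadirashviliSereginSverak2009, Prop. 4.1 (4.5)] -/
theorem exists_regular_flow :
    ∃ c₁ : ℝ, 0 < c₁ ∧ ∃ C₁ : ℝ, 0 ≤ C₁ ∧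
      ∀ ⦃A : ℝ⦄, 0 < A → ∀ ⦃a₀ : (EuclideanSpace ℝ (Fin 3)) → (EuclideanSpace ℝ (Fin 3))⦄,
        AEStronglyMeasurable a₀ volume → MemLp a₀ 3 volume → IsWeaklyDivFree a₀ →
        eLpNorm a₀ ∞ volume ≤ ENNReal.ofReal A →
        ∃ (a : ℝ → (EuclideanSpace ℝ (Fin 3)) → (EuclideanSpace ℝ (Fin 3))) (π pK : ℝ → (EuclideanSpace ℝ (Fin 3)) → ℝ),
          IsLocalLeraySolutionOn (c₁ / A ^ 2) 1 a₀ a pK ∧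
          IsClassicalNSSolutionOn (Ioo 0 (4 * c₁ / A ^ 2)) 1 0 a π ∧
          (∀ t ∈ Ioo 0 (4 * c₁ / A ^ 2), ∀ x, ‖a t x‖ ≤ 2 * A) ∧
          ∀ t ∈ Ioo 0 (c₁ / A ^ 2), ∀ x, Real.sqrt t * ‖fderiv ℝ (a t) x‖ ≤ C₁ * A := by
  obtain ⟨c₀, hc₀, hKato⟩ := kato_local_bounded_holds
  obtain ⟨ε₁, hε₁, C, hC, hL⟩ := knss2009_local_smoothing_holds (E := EuclideanSpace ℝ (Fin 3)) 1 0
  refine ⟨min (c₀ / 4) (ε₁ / 4), by positivity, 2 * C, by positivity, ?_⟩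
  intro A hA a₀ ha₀m ha₀3 hdiv hbd
  set c₁ : ℝ := min (c₀ / 4) (ε₁ / 4) with hc₁
  have hc₁pos : 0 < c₁ := by positivity
  have hc₁c₀ : c₁ ≤ c₀ / 4 := min_le_left _ _
  have hc₁ε₁ : c₁ ≤ ε₁ / 4 := min_le_right _ _
  have hA2 : 0 < A ^ 2 := by positivity
  -- ## the Kato solution and its lifespan `T_K = c₀/A²`
  obtain ⟨w, hw, hwb⟩ := hKato one_pos hA ha₀3 hdiv hbd
  set TK : ℝ := c₀ * 1 / A ^ 2 with hTK
  have hTKpos : 0 < TK := by positivity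
  have h4c : 4 * c₁ / A ^ 2 ≤ TK := by
    rw [hTK, mul_one]
    exact div_le_div_of_nonneg_right (by linarith) hA2.le
  have hS : 0 < c₁ / A ^ 2 := by positivity
  have hSTK : c₁ / A ^ 2 < TK := by
    rw [hTK, mul_one]
    exact div_lt_div_of_pos_right (by linarith) hA2
  -- ## the local Leray pressure on the slab `(0, c₁/A²)`
  obtain ⟨pK, hLK⟩ := kato_isLocalLeraySolutionOn_holds 1 TK a₀ w one_pos hw (c₁ / A ^ 2) hS hSTK
  -- ## the classical smooth representative on `(0, T_K)`
  obtain ⟨a, π, hcl, haw⟩ := mild_L3_smooth_holds one_pos hTKpos ha₀3 hdiv hw.mild hw.continuousInLpOn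
    hw.aestronglyMeasurable
  have hcont : ContinuousOn (uncurry a) (Ioo 0 TK ×ˢ (univ : Set (EuclideanSpace ℝ (Fin 3)))) :=
    hcl.smooth_velocity.continuousOn
  have ham : AEStronglyMeasurable (uncurry a)
      (volume.restrict (Ioo 0 (c₁ / A ^ 2) ×ˢ (univ : Set (EuclideanSpace ℝ (Fin 3))))) :=
    (hcont.mono (prod_mono (Ioo_subset_Ioo_right hSTK.le) Subset.rfl)).aestronglyMeasurable
      (measurableSet_Ioo.prod MeasurableSet.univ)
  have hLKa : IsLocalLeraySolutionOn (c₁ / A ^ 2) 1 a₀ a pK :=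
    isLocalLeraySolutionOn_congr_slices hS hLK ham fun t ht => haw t ⟨ht.1, ht.2.trans hSTK⟩
  -- ## the pointwise bound
  have hbound : ∀ t ∈ Ioo 0 TK, ∀ x, ‖a t x‖ ≤ 2 * A := fun t ht x =>
    norm_le_of_continuous_of_ae_eq (by positivity) (hcl.contDiff_velocity ht).continuous (haw t ht)
      (hwb t ⟨ht.1.le, ht.2⟩) x
  -- ## the gradient bound: the Oseen equation from `t = 0` and KNSS's local smooth solution
  set T₁ : ℝ := TK / 2 with hT₁
  have hT₁TK : T₁ < TK := by rw [hT₁]; linarith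
  have hST₁ : c₁ / A ^ 2 < T₁ := by
    rw [hT₁, hTK, mul_one]
    rw [show c₀ / A ^ 2 / 2 = (c₀ / 2) / A ^ 2 by ring]
    exact div_lt_div_of_pos_right (by linarith) hA2
  obtain ⟨ū, hūw, hūM, hūm⟩ := exists_retract_representative (S := Ico 0 TK) (W := Ioo 0 TK)
    (M := 2 * A) (by positivity) hwb hw.aestronglyMeasurable
  have hūm' : AEStronglyMeasurable (uncurry ū)
      (volume.restrict (Ioo 0 T₁ ×ˢ (univ : Set (EuclideanSpace ℝ (Fin 3))))) :=
    hūm.mono_measure (Measure.restrict_mono (prod_mono (Ioo_subset_Ioo_right hT₁TK.le) Subset.rfl) le_rfl)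
  obtain ⟨L, hL3⟩ := ContinuousInLpOn.exists_forall_eLpNorm_le hw.continuousInLpOn
    (by norm_num : (1 : ℝ≥0∞) ≤ 3) isCompact_Icc
    (show Icc 0 T₁ ⊆ Ico 0 TK from fun τ hτ => ⟨hτ.1, hτ.2.trans_lt hT₁TK⟩)
  have hrep : ∀ τ ∈ Ioo 0 T₁, ū τ =ᵐ[volume] w τ := fun τ hτ => hūw τ ⟨hτ.1.le, hτ.2.trans hT₁TK⟩
  have hOseen : ∀ t ∈ Ioo 0 T₁, w t =ᵐ[volume] fun x =>
      UnboundedOperators.heatExtension a₀ (1 * (t - 0)) x - oseenDuhamel 1 0 w w t x := by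
    intro t ht
    have htTK : t < TK := ht.2.trans hT₁TK
    have hmild := IsMildNSSolutionOn.isMildNSSolutionBetween_of_continuousInLpOn one_pos ha₀3 hw.mild
      hw.continuousInLpOn hw.aestronglyMeasurable le_rfl ht.1.le htTK
    have h0 : (0 : ℝ) ∈ Ico 0 TK := ⟨le_rfl, hTKpos⟩
    have htI : t ∈ Ico 0 TK := ⟨ht.1.le, htTK⟩
    have hid := ae_eq_heatExtension_sub_oseenDuhamel_of_memLp_three one_pos ht.1 ht.2.le
      (M := 2 * A) (by positivity) hūm' (fun τ _ y => hūM τ y) hrep ENNReal.coe_lt_top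
      (fun τ hτ => hL3 τ ⟨hτ.1.le, hτ.2.le⟩) (hw.memLp h0) (hw.mild.1 0 h0) (hw.memLp htI)
      (hw.mild.1 t htI) hmild
    have hcongr : ∀ x, oseenDuhamel 1 0 ū ū t x = oseenDuhamel 1 0 w w t x := fun x =>
      oseenDuhamel_congr_ae_slice (fun τ hτ => hrep τ ⟨hτ.1, hτ.2.trans_le ht.2.le⟩)
        (fun τ hτ => hrep τ ⟨hτ.1, hτ.2.trans_le ht.2.le⟩) x
    filter_upwards [hid] with x hx
    rw [hx, hcongr x, hw.initial]
  have hbd2 : eLpNorm a₀ ∞ volume ≤ ENNReal.ofReal (2 * A) :=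
    hbd.trans (ENNReal.ofReal_le_ofReal (by linarith))
  have hwm₁ : AEStronglyMeasurable (uncurry w)
      (volume.restrict (Ioo 0 T₁ ×ˢ (univ : Set (EuclideanSpace ℝ (Fin 3))))) :=
    hw.aestronglyMeasurable.mono_measure
      (Measure.restrict_mono (prod_mono (Ioo_subset_Ioo_right hT₁TK.le) Subset.rfl) le_rfl)
  have hwM₁ : ∀ t ∈ Ioo 0 T₁, eLpNorm (w t) ∞ volume ≤ ENNReal.ofReal (2 * A) := fun t ht =>
    hwb t ⟨ht.1.le, ht.2.trans hT₁TK⟩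
  obtain ⟨v₁, hv₁s, hv₁ae, -, -, hv₁grad⟩ := exists_local_smooth_representative hL one_pos
    (by positivity : 0 < 2 * A) hC ha₀m hbd2 hwm₁ hwM₁ hOseen
  refine ⟨a, π, pK, hLKa, hcl.mono (Ioo_subset_Ioo_right h4c) isOpen_Ioo.uniqueDiffOn,
    fun t ht x => hbound t ⟨ht.1, ht.2.trans_le h4c⟩ x, fun t ht x => ?_⟩
  -- the windows
  have hwin : (0 : ℝ) + ε₁ * 1 / (2 * A) ^ 2 = ε₁ / 4 / A ^ 2 := by ring
  have ht1 : t < 0 + ε₁ * 1 / (2 * A) ^ 2 := by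
    rw [hwin]
    exact ht.2.trans_le (div_le_div_of_nonneg_right hc₁ε₁ hA2.le)
  have ht2 : t < T₁ := ht.2.trans hST₁
  have htTK : t < TK := ht2.trans hT₁TK
  -- `a t = v₁ t` (both continuous, a.e. equal)
  have hav : a t = v₁ t := by
    have h1 : a t =ᵐ[volume] v₁ t := (haw t ⟨ht.1, htTK⟩).trans (hv₁ae t ⟨ht.1, lt_min ht1 ht2⟩)
    have hca : Continuous (a t) := (hcl.contDiff_velocity ⟨ht.1, htTK⟩).continuous
    have hcv : Continuous (v₁ t) := by
      have hinc : Continuous fun x : EuclideanSpace ℝ (Fin 3) => ((t, x) : ℝ × EuclideanSpace ℝ (Fin 3)) :=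
        continuous_const.prodMk continuous_id
      have h := hv₁s.continuousOn.comp_continuous hinc fun x => ⟨⟨ht.1, ht1⟩, mem_univ x⟩
      exact h
    exact (hca.ae_eq_iff_eq volume hcv).1 h1
  have hg := hv₁grad t ⟨ht.1, ht1⟩ x
  simp only [sub_zero, one_mul, pow_zero, mul_one, Nat.cast_one, iteratedDeriv_zero] at hg
  rw [hav, ← norm_iteratedFDeriv_zero (𝕜 := ℝ) (f := fderiv ℝ (v₁ t)) (x := x), norm_iteratedFDeriv_fderiv,
    Real.sqrt_eq_rpow]
  have e : ‖iteratedFDeriv ℝ (0 + 1) (v₁ t) x‖ = ‖iteratedFDeriv ℝ 1 (fun y => v₁ t y) x‖ := rfl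
  rw [e]
  linarith [hg]

end JiaSverak2014

end Literature.Analysis.FluidPDE

end
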